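import Summits.AtomisticToContinuum.HydrodynamicLimit.Theorems.AntiMazurCoboundariesPressureCertificateTransfer
import Literature.Analysis.FluidPDE.HardSphereFlowJointMeasurable
import HarnessLib

/-!
# Window means of observables along a hard-sphere flow under an invariant law

Helpers (Fubini/Tonelli + invariance) for the refutation of
`OneFlightGossipEngine.BandCoherenceLDAlongFamilies` (stmt-AtomisticToContinuum-17700).

For a hard-sphere flow `Φ` on `𝕋³`, a law `μ` on phase space preserved by every time-`t` map `Φ_t`
and carried by the good set, and a window `a ≤ b`, the window integral `z ↦ ∫_a^b f(Φ_s z) ds` of a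
real observable `f` is `μ`-integrable with mean `(b − a) ∫ f dμ`:

* `integral_intervalIntegral_comp_flow_of_integrable_prod` — the core step, for `(s, z) ↦ f(Φ_s z)`
  integrable on `Lebesgue|(a,b] ⊗ μ`: Bochner–Fubini in both orders plus invariance
  `∫ f ∘ Φ_s dμ = ∫ f dμ`;
* `integral_intervalIntegral_comp_flow` (W1) — `μ` finite, `f` bounded measurable;
* `integral_intervalIntegral_comp_flow_of_nonneg` (W2) — `μ` finite, `f ≥ 0` measurable and
  `μ`-integrable (product integrability by Tonelli + invariance,
  `AntiMazurCertificate.lintegral_setLIntegral_comp_flow`).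

The flow is only separately measurable; joint a.e.-measurability on `ν ⊗ μ` for `μ` carried by the
good set is `BoltzmannGreenKuboOrthMomentum.aemeasurable_uncurry_flow`.

References: S. Olla, S. R. S. Varadhan, H.-T. Yau, *Hydrodynamical limit for a Hamiltonian system
with weak noise*, CMP 155 (1993), §2 (the time-averaging step of the entropy method);
C. Kipnis, C. Landim, *Scaling Limits of Interacting Particle Systems* (1999), Ch. 7 §2.
-/

noncomputable section

open MeasureTheory ProbabilityTheory Set Filter Topology
open scoped ENNReal

namespace Summit.AtomisticToContinuum.HydrodynamicLimit.Theorems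

namespace BandCoherenceLDRefutation

open Literature.MathematicalPhysics.KineticTheory Literature.Analysis.FluidPDE

/-- **Fubini + invariance** (core step). If `(s, z) ↦ f(Φ_s z)` is integrable on
`Lebesgue|(a,b] ⊗ μ` for a law `μ` preserved by every `Φ_t` and a measurable `f`, then the window
integral `z ↦ ∫_a^b f(Φ_s z) ds` is `μ`-integrable with mean `(b − a) ∫ f dμ`. [folklore] -/
theorem integral_intervalIntegral_comp_flow_of_integrable_prod {N : ℕ} {ε : ℝ}
    (Φ : HardSphereFlow (Torus.geometry (Fin 3)) ε N)
    (μ : Measure (Config N (Fin 3) T3)) [SFinite μ] (hinv : ∀ t, MeasurePreserving (Φ.flow t) μ μ)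
    {f : Config N (Fin 3) T3 → ℝ} (hf : Measurable f) {a b : ℝ} (hab : a ≤ b)
    (hint : Integrable (fun p : ℝ × Config N (Fin 3) T3 => f (Φ.flow p.1 p.2))
      ((volume.restrict (Ioc a b)).prod μ)) :
    Integrable (fun z => ∫ s in a..b, f (Φ.flow s z)) μ ∧
      ∫ z, (∫ s in a..b, f (Φ.flow s z)) ∂μ = (b - a) * ∫ z, f z ∂μ := by
  simp_rw [intervalIntegral.integral_of_le hab]
  refine ⟨hint.integral_prod_right, ?_⟩
  have hs : ∀ s : ℝ, ∫ z, f (Φ.flow s z) ∂μ = ∫ z, f z ∂μ := fun s => by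
    have hfm : AEStronglyMeasurable f (Measure.map (Φ.flow s) μ) := by
      rw [(hinv s).map_eq]
      exact hf.aestronglyMeasurable
    rw [← integral_map (hinv s).measurable.aemeasurable hfm, (hinv s).map_eq]
  rw [← integral_prod_symm _ hint, integral_prod _ hint]
  simp only [hs]
  rw [setIntegral_const, Real.volume_real_Ioc_of_le hab, smul_eq_mul]

/-- **Fubini + invariance for bounded observables** (W1). For a finite law `μ` preserved by every
`Φ_t` and carried by the good set, and a bounded measurable `f`, the window integral
`z ↦ ∫_a^b f(Φ_s z) ds` (`a ≤ b`) is `μ`-integrable with mean `(b − a) ∫ f dμ`. [folklore] -/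
theorem integral_intervalIntegral_comp_flow {N : ℕ} {ε : ℝ}
    (Φ : HardSphereFlow (Torus.geometry (Fin 3)) ε N)
    (μ : Measure (Config N (Fin 3) T3)) [IsFiniteMeasure μ] (hinv : ∀ t, MeasurePreserving (Φ.flow t) μ μ)
    (hgood : μ Φ.goodᶜ = 0) {f : Config N (Fin 3) T3 → ℝ} (hf : Measurable f) {C : ℝ} (hC : ∀ z, |f z| ≤ C)
    {a b : ℝ} (hab : a ≤ b) :
    Integrable (fun z => ∫ s in a..b, f (Φ.flow s z)) μ ∧
      ∫ z, (∫ s in a..b, f (Φ.flow s z)) ∂μ = (b - a) * ∫ z, f z ∂μ := by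
  refine integral_intervalIntegral_comp_flow_of_integrable_prod Φ μ hinv hf hab ?_
  have hflow : AEMeasurable (fun p : ℝ × Config N (Fin 3) T3 => Φ.flow p.1 p.2)
      ((volume.restrict (Ioc a b)).prod μ) :=
    BoltzmannGreenKuboOrthMomentum.aemeasurable_uncurry_flow Φ _ μ hgood
  refine Integrable.of_bound (hf.comp_aemeasurable hflow).aestronglyMeasurable C
    (ae_of_all _ fun p => ?_)
  rw [Real.norm_eq_abs]
  exact hC _

/-- **Tonelli + invariance for nonnegative integrable observables** (W2). For a finite law `μ`
preserved by every `Φ_t` and carried by the good set, and a measurable, `μ`-integrable `f ≥ 0`, the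
window integral `z ↦ ∫_a^b f(Φ_s z) ds` (`a ≤ b`) is `μ`-integrable with mean at most (in fact
equal to) `(b − a) ∫ f dμ`. [folklore] -/
theorem integral_intervalIntegral_comp_flow_of_nonneg {N : ℕ} {ε : ℝ}
    (Φ : HardSphereFlow (Torus.geometry (Fin 3)) ε N)
    (μ : Measure (Config N (Fin 3) T3)) [IsFiniteMeasure μ] (hinv : ∀ t, MeasurePreserving (Φ.flow t) μ μ)
    (hgood : μ Φ.goodᶜ = 0) {f : Config N (Fin 3) T3 → ℝ} (hf : Measurable f) (hf0 : ∀ z, 0 ≤ f z)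
    (hfi : Integrable f μ) {a b : ℝ} (hab : a ≤ b) :
    Integrable (fun z => ∫ s in a..b, f (Φ.flow s z)) μ ∧
      ∫ z, (∫ s in a..b, f (Φ.flow s z)) ∂μ ≤ (b - a) * ∫ z, f z ∂μ := by
  have hflow : AEMeasurable (fun p : ℝ × Config N (Fin 3) T3 => Φ.flow p.1 p.2)
      ((volume.restrict (Ioc a b)).prod μ) :=
    BoltzmannGreenKuboOrthMomentum.aemeasurable_uncurry_flow Φ _ μ hgood
  have hint : Integrable (fun p : ℝ × Config N (Fin 3) T3 => f (Φ.flow p.1 p.2))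
      ((volume.restrict (Ioc a b)).prod μ) := by
    refine ⟨(hf.comp_aemeasurable hflow).aestronglyMeasurable, ?_⟩
    have hGf : AEMeasurable (fun p : ℝ × Config N (Fin 3) T3 => ENNReal.ofReal (f (Φ.flow p.1 p.2)))
        ((volume.restrict (Ioc a b)).prod μ) :=
      hf.ennreal_ofReal.comp_aemeasurable hflow
    have h1 := lintegral_prod_symm _ hGf
    simp only at h1
    rw [hasFiniteIntegral_iff_ofReal (ae_of_all _ fun p => hf0 _), h1,
      AntiMazurCertificate.lintegral_setLIntegral_comp_flow Φ μ hinv hgood hf.ennreal_ofReal a b]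
    exact ENNReal.mul_lt_top measure_Ioc_lt_top
      ((hasFiniteIntegral_iff_ofReal (ae_of_all _ hf0)).1 hfi.hasFiniteIntegral)
  obtain ⟨h1, h2⟩ := integral_intervalIntegral_comp_flow_of_integrable_prod Φ μ hinv hf hab hint
  exact ⟨h1, h2.le⟩

end BandCoherenceLDRefutation

end Summit.AtomisticToContinuum.HydrodynamicLimit.Theorems

end
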